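/-
Copyright: statement-level skeleton of a published paper (lit-balaban cell, Phase-2 proof seat p25, gen 16). No proof
claims beyond what the kernel checks below.
-/
import Literature.MathematicalPhysics.QuantumFieldTheory.BalabanImbrieJaffe1984to88.BIJ88LabelledRunEnv311
import Literature.MathematicalPhysics.QuantumFieldTheory.BalabanImbrieJaffe1984to88.BIJ88VertexComponentsExpansion311

/-!
# `BalabanImbrieJaffe1984to88.BIJ88LabelledExpansion311` — T. Bałaban, J. Imbrie, A. Jaffe, *Effective action and
cluster properties of the abelian Higgs model*, Commun. Math. Phys. **114** (1988) 257–315 [BalabanImbrieJaffe1988],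
§5.14 p. 311–312 [PDF 55–56] *"After sufficiently many integrations by parts, all components of X will be complete. We
break up the observable according to the connected components of X. The components containing contractions to χ′ … or
at least m̄+1 interactions are called remainder components {X_r}. The other components are called constant components
{X_c} … Summing all terms in X_r gives an observable F_{k,rem}(X_r)."* — **THE LABELLED COMPONENT EXPANSION AND ITS
IDENTITY**: the observables `F_{k,loc}(X_{σ_i})` (leg lists `obs i`, `i ∈ K`) are taken up one at a time (the least
untouched index first), each runs (`BIJ88LabelledRun311.run`) until its component is complete; a CONSTANT component is
booked as a block of the term (`RTerm.consts`), a remainder component is set aside and stays available for later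
contractions (`RTerm.groups`).  Nothing is lost: the Gaussian integral of the product of all legs against `χe^{−V}`
equals the sum over the terms of coefficient × the integral of the pending legs against `(Π_{dirs}∂)χ·e^{−V}`
(`expand_val`), the multiset twin of p25 gen 15's `cexpansion` — with the components now carrying the observables
they contain, so that the constant blocks `{X_c}` and the remainder components `{X_r}` of every term are SETS OF
OBSERVABLES.

statement-level skeleton of published theorems with citation tags; proofs where landed; nothing here is a claim
about the Yang–Mills mass gap

PDF held: `paper:balaban1988-cmp114-bij-abelian-higgs-effective-action` (journal page = PDF page + 256); p. 311–312 =
PDF 55–56 (`p0055.txt` L23–38, `p0056.txt` L1–9 re-read this session).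

CITATION HEADER (lean-in-tree rule).  lit-balaban cell (HOME `run/shared/lean/pub/lit-balaban/`), Phase 2, seat p25
gen 16; row **C2.Claim@312** of `HOME/lit-balaban-r16/ROWS-C2-part2.md` (owner r16, referee ref-5; head untouched).
USED BY NAME, nothing restated: `BIJ88LabelledRun311`/`BIJ88LabelledRunEnv311` (this seat and generation),
`BIJ88VertexComponentsExpansion311.{gint, gint_cons}` and `BIJ88VertexIbp311.lmono` (p25 gen 15),
`BIJ88WickDerivatives305.dlist` (p25 gen 14), `B2Eq228Conditioning.{weight, source}`.

## What is proved (0 `sorry`, standard axioms, no new `Prop` facts; definitions with bodies: `RTerm`, `oact`,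
`RTerm.addConst`, `expand`, `gintM`, `legsOf`, `oval`, `tval`)

* §1 `RTerm`, `oact`, `RTerm.addConst`, **`expand`** (well-founded on the number of untouched observables;
  `expand_of_not_nonempty`, `expand_of_nonempty`), soundness **`expand_sound`** (every block is a constant component,
  every set-aside component is complete, a state with a set-aside component yields terms with set-aside components).
* §2 the multiset Gaussian integral `gintM` (`gintM_coe`: it is gen 15's `gint`, legs in any order),
  `sum_range_eraseIdx_eq` (positional ↔ multiset pairing sums), **`gintM_cons`** (one integration by parts: pair with
  any other leg ∣ source ∣ `χ′` ∣ vertex — gen 15's `gint_cons` in multiset form), `sum_map_carriers` (a pairing sum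
  over the legs of a family of carriers, carrier by carrier).
* §3 `legsOf` (all pending legs of a state; `legsOf_erase`, `legsOf_erase_done`, `legsOf_cons`), `oval` (value of an
  outcome; `sum_oval_scale`, `sum_oval_bump`, `sum_oval_push`), **`run_val`** (the run of one component loses nothing:
  `∫Π_{g ∪ env}Φ·(Π_D∂)χe^{−V} = Σ_{o ∈ run g rest done} a_o ∫Π_{o.g ∪ env_o}Φ·(Π_{D++D_o}∂)χe^{−V}`), `tval` (`tval_act`,
  `tval_addConst`), **`expand_val`** (`∫Π_{all legs of done ∪ rest}Φ·(Π_D∂)χe^{−V} = Σ_{t ∈ expand done rest} coef_t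
  ∫Π_{legs of t.groups}Φ·(Π_{D ++ dirs_t}∂)χe^{−V}`) and **`expand_val_init`** (from nothing set aside: the integral of
  the product of ALL observables' legs against `χe^{−V}dμ_{C,ℱ}`).
HONEST SCOPE: as in `BIJ88LabelledRun311` (contraction-graph components, one covariance, fixed order of events); the
analytic hypotheses are gen 15's (`A` positive definite, every `(Π∂)χ` of class `C¹` with `(Π∂)χ·e^{−V}` bounded —
discharged for smooth compactly supported `χ` in `BIJ88VertexComponentsFieldLaw312`).  NOT summit progress; NOT
continuum; NOT Clay.  Imports `BIJ88LabelledRunEnv311`, `BIJ88VertexComponentsExpansion311`; modifies nothing.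
-/

noncomputable section

namespace Literature.MathematicalPhysics.QuantumFieldTheory.BalabanImbrieJaffe1984to88.BIJ88LabelledExpansion311

open Classical MeasureTheory Matrix Finset
open scoped BigOperators
open Literature.MathematicalPhysics.QuantumFieldTheory.Balaban1983to89
open B2Eq228Conditioning (weight source)
open BIJ88VertexIbp311 (lmono vexp)
open BIJ88WickDerivatives305 (dlist)
open BIJ88VertexComponents311 (Grp maxArity)
open BIJ88VertexComponentsExpansion311 (gint gint_cons)
open BIJ88LabelledRun311 BIJ88LabelledRunEnv311

variable {S : Type} [Fintype S] [DecidableEq S] {ι : Type} [Fintype ι] {κ : Type} [LinearOrder κ]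

/-! ## §1  Terms and the expansion -/

/-- **A term of the labelled component expansion**: coefficient, `χ′`-directions (earliest first), number of vertices
differentiated down, the constant components (blocks `X_c`, with their labels) and the remainder components set aside
(`X_r`, with their labels and pending legs). [cite: BalabanImbrieJaffe1988, §5.14 p.311–312] -/
structure RTerm (S κ : Type) where
  /-- product of all contraction weights -/
  coef : ℝ
  /-- directions of the contractions to `χ′`, earliest first -/
  dirs : List (S → ℝ)
  /-- interaction vertices differentiated down -/
  nv : ℕ
  /-- the constant components `{X_c}` -/
  consts : Multiset (LGrp S κ)
  /-- the complete components set aside at the end (the remainder components `{X_r}`, and whatever was passed in) -/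
  groups : Multiset (LGrp S κ)

/-- An outcome acting on a later term: weights multiply, directions and vertex counts accumulate.
[cite: BalabanImbrieJaffe1988, §5.14 p.311] -/
@[simps] def oact (o : Outcome S κ) (t : RTerm S κ) : RTerm S κ :=
  ⟨o.a * t.coef, o.D ++ t.dirs, o.dv + t.nv, t.consts, t.groups⟩

/-- Booking a constant component as a block of the term. [cite: BalabanImbrieJaffe1988, §5.14 p.311–312] -/
@[simps] def RTerm.addConst (g : LGrp S κ) (t : RTerm S κ) : RTerm S κ := { t with consts := g ::ₘ t.consts }

variable (A : Matrix S S ℝ) (f : S → ℝ) (c : ι → ℝ) (legs : ι → List (S → ℝ)) (obs : κ → List (S → ℝ)) (M : ℕ)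

/-- **THE LABELLED COMPONENT EXPANSION** (p. 311–312): with complete components `done` set aside and observables `rest`
untouched — no observable left: the single terminal term; otherwise the least untouched observable starts a component,
which runs until complete (`run`); a CONSTANT component is booked as a block `X_c` of every resulting term, a remainder
component is set aside (available for later contractions); continue with what is left.  Well-founded on `#rest`.
[cite: BalabanImbrieJaffe1988, §5.14 p.311–312] -/
def expand : Multiset (LGrp S κ) → Finset κ → Multiset (RTerm S κ)
  | done, rest =>
    if h : rest.Nonempty then
      mbind (run A f c legs obs M (pristine obs (rest.min' h)) (rest.erase (rest.min' h)) done) fun o _ho =>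
        if o.g.IsConst M then (expand o.done o.rest).map fun t => (oact o t).addConst o.g
        else (expand (o.g ::ₘ o.done) o.rest).map (oact o)
    else {⟨1, [], 0, 0, done⟩}
  termination_by _ rest => rest.card
  decreasing_by
    all_goals
      exact lt_of_le_of_lt (Finset.card_le_card (run_rest_subset _ _ _ o _ho)) (Finset.card_erase_lt_of_mem (rest.min'_mem h))

/-- Unfolding: no observable left. [cite: BalabanImbrieJaffe1988, §5.14 p.311] -/
theorem expand_of_not_nonempty {rest : Finset κ} (h : ¬ rest.Nonempty) (done : Multiset (LGrp S κ)) :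
    expand A f c legs obs M done rest = {⟨1, [], 0, 0, done⟩} := by
  rw [expand, dif_neg h]

/-- Unfolding: the least untouched observable runs. [cite: BalabanImbrieJaffe1988, §5.14 p.311] -/
theorem expand_of_nonempty {rest : Finset κ} (h : rest.Nonempty) (done : Multiset (LGrp S κ)) :
    expand A f c legs obs M done rest
      = mbind (run A f c legs obs M (pristine obs (rest.min' h)) (rest.erase (rest.min' h)) done) fun o _ =>
          if o.g.IsConst M then (expand A f c legs obs M o.done o.rest).map fun t => (oact o t).addConst o.g
          else (expand A f c legs obs M (o.g ::ₘ o.done) o.rest).map (oact o) := by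
  rw [expand, dif_pos h]

variable {A f c legs obs M}

/-- **Soundness of the bookkeeping**: every block is a constant component, every set-aside component is complete
(given that those passed in are), and a state with a set-aside component yields terms with set-aside components.
[cite: BalabanImbrieJaffe1988, §5.14 p.311–312] -/
theorem expand_sound : ∀ (n : ℕ) (done : Multiset (LGrp S κ)) (rest : Finset κ), rest.card < n →
    (∀ h ∈ done, h.complete M = true) → ∀ t ∈ expand A f c legs obs M done rest,
      (∀ g ∈ t.consts, g.IsConst M) ∧ (∀ g ∈ t.groups, g.complete M = true) ∧ (done ≠ 0 → t.groups ≠ 0)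
  | 0, _, _, hn => fun _ _ _ => absurd hn (Nat.not_lt_zero _)
  | n + 1, done, rest, hn => by
    intro hd t ht
    by_cases h : rest.Nonempty
    · rw [expand_of_nonempty A f c legs obs M h, mem_mbind] at ht
      obtain ⟨o, ho, ht⟩ := ht
      have hcard : o.rest.card < n := lt_of_lt_of_le (lt_of_le_of_lt (Finset.card_le_card (run_rest_subset _ _ _ o ho))
        (Finset.card_erase_lt_of_mem (rest.min'_mem h))) (Nat.lt_succ_iff.1 hn)
      have hdo : ∀ h ∈ o.done, h.complete M = true :=
        fun h hh => hd h (Multiset.mem_of_le (run_done_le _ _ _ o ho) hh)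
      split_ifs at ht with hg
      · rw [Multiset.mem_map] at ht
        obtain ⟨t', ht', rfl⟩ := ht
        obtain ⟨h1, h2, h3⟩ := expand_sound n o.done o.rest hcard hdo t' ht'
        refine ⟨?_, h2, fun hne => h3 ?_⟩
        · intro g hg'
          simp only [RTerm.addConst_consts, oact_consts, Multiset.mem_cons] at hg'
          rcases hg' with rfl | hg'
          · exact hg
          · exact h1 g hg'
        · rw [(run_const _ _ _ o ho hd hg).2]; exact hne
      · rw [Multiset.mem_map] at ht
        obtain ⟨t', ht', rfl⟩ := ht
        have hdo' : ∀ h ∈ o.g ::ₘ o.done, h.complete M = true := fun h hh => by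
          rcases Multiset.mem_cons.1 hh with rfl | hh
          · exact run_complete _ _ _ o ho
          · exact hdo h hh
        obtain ⟨h1, h2, h3⟩ := expand_sound n _ o.rest hcard hdo' t' ht'
        exact ⟨h1, h2, fun _ => h3 (Multiset.cons_ne_zero)⟩
    · rw [expand_of_not_nonempty A f c legs obs M h, Multiset.mem_singleton] at ht
      subst ht
      exact ⟨fun g hg => absurd hg (Multiset.notMem_zero _), hd, fun hne => hne⟩

/-! ## §2  The multiset Gaussian integral and one integration by parts -/

omit [DecidableEq S] in
/-- Monomials do not depend on the order of the legs. [folklore] -/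
private theorem lmono_perm {P P' : List (S → ℝ)} (h : P.Perm P') (φ : S → ℝ) : lmono P φ = lmono P' φ := by
  unfold lmono
  exact (h.map _).prod_eq

variable (A f c legs) (χ : (S → ℝ) → ℝ)

/-- **The Gaussian integral of a MULTISET of legs against `(Π_{z∈D}∂_z)χ · e^{−V} dμ_{C,ℱ}`** — gen 15's `gint`, which
does not depend on the order of the legs. [cite: BalabanImbrieJaffe1988, §5.14 p.311–312] -/
def gintM (P : Multiset (S → ℝ)) (D : List (S → ℝ)) : ℝ :=
  Quotient.liftOn P (fun L => gint A f χ c legs L D) fun L L' (h : L.Perm L') => by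
    unfold gint
    exact integral_congr_ae (Filter.Eventually.of_forall fun φ => by simp only [lmono_perm h φ])

omit [DecidableEq S] in
/-- On a list of legs `gintM` is `gint`. [cite: BalabanImbrieJaffe1988, §5.14 p.311] -/
@[simp] theorem gintM_coe (L D : List (S → ℝ)) : gintM A f c legs χ (L : Multiset (S → ℝ)) D = gint A f χ c legs L D :=
  rfl

omit [Fintype S] [DecidableEq S] in
/-- **Positional pairing sums are multiset pairing sums**: `Σ_{i<|R|} F(R_i, R∖R_i) = Σ_{w ∈ R} F(w, R∖w)` for the
legs as a multiset. [cite: BalabanImbrieJaffe1988, §5.14 p.311] -/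
theorem sum_range_eraseIdx_eq {X : Type} [DecidableEq X] (d : X) (F : X → Multiset X → ℝ) :
    ∀ R : List X, ∑ i ∈ range R.length, F (R.getD i d) (R.eraseIdx i : List X)
      = ((R : Multiset X).map fun w => F w ((R : Multiset X).erase w)).sum
  | [] => by simp
  | a :: R => by
    rw [List.length_cons, Finset.sum_range_succ', Multiset.map_coe, List.map_cons, Multiset.sum_coe,
      List.sum_cons]
    simp only [List.getD_cons_zero, List.eraseIdx_cons_zero, List.getD_cons_succ, List.eraseIdx_cons_succ,
      Multiset.coe_erase, List.erase_cons_head]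
    rw [add_comm]
    congr 1
    have ih := sum_range_eraseIdx_eq d (fun w Q => F w (a ::ₘ Q)) R
    simp only [Multiset.cons_coe] at ih
    rw [ih, ← Multiset.sum_coe, ← Multiset.map_coe]
    refine congrArg _ (Multiset.map_congr rfl fun w hw => ?_)
    conv_rhs => rw [← Multiset.coe_erase, ← Multiset.cons_coe, Multiset.erase_cons_tail_of_mem hw, Multiset.coe_erase]
    rw [Multiset.coe_erase]

/-- **ONE INTEGRATION BY PARTS, MULTISET FORM** (gen 15's `gint_cons`): the head leg `Φ(u)` pairs with any other leg
(weight `⟨A⁻¹u, w⟩`), goes to the source (`⟨A⁻¹u, ℱ⟩`), to `χ′` (one more direction `A⁻¹u`), or differentiates down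
the vertex `m` through its leg `j` (weight `−c_m⟨A⁻¹u, w_{m,j}⟩`, the other legs join).
[cite: BalabanImbrieJaffe1988, §5.14 p.311] -/
theorem gintM_cons (hA : A.PosDef) (hχ : ∀ D : List (S → ℝ), ContDiff ℝ 1 (dlist D χ))
    (h0 : ∀ D : List (S → ℝ), ∃ K, ∀ φ, ‖dlist D χ φ * vexp c legs φ‖ ≤ K) (u : S → ℝ) (P : Multiset (S → ℝ))
    (D : List (S → ℝ)) :
    gintM A f c legs χ (u ::ₘ P) D
      = (P.map fun w => ((A⁻¹ *ᵥ u) ⬝ᵥ w) * gintM A f c legs χ (P.erase w) D).sum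
        + ((A⁻¹ *ᵥ u) ⬝ᵥ f) * gintM A f c legs χ P D
        + gintM A f c legs χ P (D ++ [A⁻¹ *ᵥ u])
        + ∑ m, ∑ j ∈ range (legs m).length, (-(c m * ((A⁻¹ *ᵥ u) ⬝ᵥ (legs m).getD j 0))) *
            gintM A f c legs χ (P + ((legs m).eraseIdx j : List (S → ℝ))) D := by
  induction P using Quot.ind with
  | mk R =>
    simp only [Multiset.quot_mk_to_coe'', Multiset.coe_add, Multiset.cons_coe]
    rw [← sum_range_eraseIdx_eq 0 (fun w Q => ((A⁻¹ *ᵥ u) ⬝ᵥ w) * gintM A f c legs χ Q D) R]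
    simp only [gintM_coe]
    exact gint_cons A f χ c legs hA hχ h0 u R D

omit [Fintype S] [DecidableEq S] in
/-- **A pairing sum over the legs of a family of carriers, carrier by carrier**: for carriers `C` with legs `ℓ`,
`Σ_{w ∈ ⋃_c ℓ c} G(w, rest of the legs) = Σ_{c ∈ C} Σ_{w ∈ ℓ c} G(w, (ℓ c ∖ w) + legs of the other carriers)`.
[cite: BalabanImbrieJaffe1988, §5.14 p.311] -/
theorem sum_map_carriers {X γ : Type} [DecidableEq X] [DecidableEq γ] (ℓ : γ → Multiset X) :
    ∀ (C : Multiset γ) (G : X → Multiset X → ℝ),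
      (((C.map ℓ).sum).map fun w => G w (((C.map ℓ).sum).erase w)).sum
        = (C.map fun c => ((ℓ c).map fun w => G w ((ℓ c).erase w + ((C.erase c).map ℓ).sum)).sum).sum := by
  intro C
  induction C using Multiset.induction_on with
  | empty => intro G; simp
  | cons c C ih =>
    intro G
    rw [Multiset.map_cons, Multiset.sum_cons, Multiset.map_add, Multiset.sum_add, Multiset.map_cons,
      Multiset.sum_cons, Multiset.erase_cons_head]
    congr 1
    · refine congrArg _ (Multiset.map_congr rfl fun w hw => ?_)
      rw [Multiset.erase_add_left_pos _ hw]
    · have e : ∀ w ∈ (C.map ℓ).sum, (ℓ c + (C.map ℓ).sum).erase w = ℓ c + ((C.map ℓ).sum).erase w :=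
        fun w hw => Multiset.erase_add_right_pos _ hw
      rw [Multiset.map_congr rfl fun w hw => by rw [e w hw], ih (fun w Q => G w (ℓ c + Q))]
      refine congrArg _ (Multiset.map_congr rfl fun c' hc' => congrArg _ (Multiset.map_congr rfl fun w _ => ?_))
      rw [Multiset.erase_cons_tail_of_mem hc', Multiset.map_cons, Multiset.sum_cons, add_left_comm]

/-! ## §3  The identity: nothing is lost -/

variable (obs)

/-- **All pending legs of a state**: the pending legs of the components set aside and the legs of the untouched
observables. [cite: BalabanImbrieJaffe1988, §5.14 p.311] -/
def legsOf (done : Multiset (LGrp S κ)) (rest : Finset κ) : Multiset (S → ℝ) :=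
  (done.map fun h => (h.pend : Multiset (S → ℝ))).sum + (rest.val.map fun j => (obs j : Multiset (S → ℝ))).sum

omit [Fintype S] [DecidableEq S] [LinearOrder κ] in
/-- Taking an untouched observable out of the environment. [cite: BalabanImbrieJaffe1988, §5.14 p.311] -/
theorem legsOf_erase [DecidableEq κ] (done : Multiset (LGrp S κ)) {rest : Finset κ} {j : κ} (hj : j ∈ rest) :
    legsOf obs done rest = (obs j : Multiset (S → ℝ)) + legsOf obs done (rest.erase j) := by
  unfold legsOf
  conv_lhs => rw [← Finset.insert_erase hj, Finset.insert_val_of_notMem (Finset.notMem_erase j rest)]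
  rw [Multiset.map_cons, Multiset.sum_cons]
  abel

omit [Fintype S] [DecidableEq S] [LinearOrder κ] in
/-- Taking a set-aside component out. [cite: BalabanImbrieJaffe1988, §5.14 p.311] -/
theorem legsOf_erase_done [DecidableEq κ] {done : Multiset (LGrp S κ)} (rest : Finset κ) {h : LGrp S κ} (hh : h ∈ done) :
    legsOf obs done rest = (h.pend : Multiset (S → ℝ)) + legsOf obs (done.erase h) rest := by
  unfold legsOf
  conv_lhs => rw [← Multiset.cons_erase hh]
  rw [Multiset.map_cons, Multiset.sum_cons, add_assoc]

omit [Fintype S] [DecidableEq S] [LinearOrder κ] in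
/-- Setting a component aside. [cite: BalabanImbrieJaffe1988, §5.14 p.311] -/
theorem legsOf_cons (done : Multiset (LGrp S κ)) (rest : Finset κ) (g : LGrp S κ) :
    legsOf obs (g ::ₘ done) rest = (g.pend : Multiset (S → ℝ)) + legsOf obs done rest := by
  unfold legsOf
  rw [Multiset.map_cons, Multiset.sum_cons, add_assoc]

/-- **The value of an outcome** given the `χ′`-directions `D` already present: its weight times the Gaussian integral
of all pending legs left (its component's, the set-aside components', the untouched observables') against
`(Π_{z ∈ D ++ D_o}∂_z)χ · e^{−V}`. [cite: BalabanImbrieJaffe1988, §5.14 p.311–312] -/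
def oval (D : List (S → ℝ)) (o : Outcome S κ) : ℝ :=
  o.a * gintM A f c legs χ ((o.g.pend : Multiset (S → ℝ)) + legsOf obs o.done o.rest) (D ++ o.D)

omit [DecidableEq S] [LinearOrder κ] in
/-- Values of scaled outcomes (bookkeeping). [cite: BalabanImbrieJaffe1988, §5.14 p.311] -/
theorem sum_oval_scale (D : List (S → ℝ)) (w : ℝ) (X : Multiset (Outcome S κ)) :
    ((X.map (Outcome.scale w)).map (oval A f c legs obs χ D)).sum = w * (X.map (oval A f c legs obs χ D)).sum := by
  rw [Multiset.map_map, ← Multiset.sum_map_mul_left]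
  refine congrArg _ (Multiset.map_congr rfl fun o _ => ?_)
  simp only [oval, Function.comp_apply, Outcome.scale_a, Outcome.scale_g, Outcome.scale_done, Outcome.scale_rest,
    Outcome.scale_D, mul_assoc]

omit [DecidableEq S] [LinearOrder κ] in
/-- Values of scaled outcomes with a vertex recorded (bookkeeping). [cite: BalabanImbrieJaffe1988, §5.14 p.311] -/
theorem sum_oval_bump (D : List (S → ℝ)) (w : ℝ) (X : Multiset (Outcome S κ)) :
    ((X.map fun o => (o.scale w).bump).map (oval A f c legs obs χ D)).sum = w * (X.map (oval A f c legs obs χ D)).sum := by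
  rw [Multiset.map_map, ← Multiset.sum_map_mul_left]
  refine congrArg _ (Multiset.map_congr rfl fun o _ => ?_)
  simp only [oval, Function.comp_apply, Outcome.bump_a, Outcome.bump_g, Outcome.bump_done, Outcome.bump_rest,
    Outcome.bump_D, Outcome.scale_a, Outcome.scale_g, Outcome.scale_done, Outcome.scale_rest, Outcome.scale_D, mul_assoc]

omit [DecidableEq S] [LinearOrder κ] in
/-- Values of outcomes with an earlier `χ′`-direction recorded (bookkeeping). [cite: BalabanImbrieJaffe1988, §5.14 p.311] -/
theorem sum_oval_push (D : List (S → ℝ)) (z : S → ℝ) (X : Multiset (Outcome S κ)) :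
    ((X.map (Outcome.push z)).map (oval A f c legs obs χ D)).sum = (X.map (oval A f c legs obs χ (D ++ [z]))).sum := by
  rw [Multiset.map_map]
  refine congrArg _ (Multiset.map_congr rfl fun o _ => ?_)
  simp only [oval, Function.comp_apply, Outcome.push_a, Outcome.push_g, Outcome.push_done, Outcome.push_rest,
    Outcome.push_D, List.append_assoc, List.singleton_append]

variable {A f c legs χ obs}

/-- **THE RUN OF ONE COMPONENT LOSES NOTHING** (p. 311, the six events are one integration by parts each):
`∫ Π_{g.pend ∪ legsOf done rest}Φ · (Π_D∂)χ · e^{−V} dμ = Σ_{o ∈ run g rest done} a_o · ∫ Π_{o.g.pend ∪ legsOf o.done o.rest}Φ · (Π_{D ++ D_o}∂)χ · e^{−V} dμ`.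
[cite: BalabanImbrieJaffe1988, §5.14 p.311–312] -/
theorem run_val (hA : A.PosDef) (hχ : ∀ D : List (S → ℝ), ContDiff ℝ 1 (dlist D χ))
    (h0 : ∀ D : List (S → ℝ), ∃ K, ∀ φ, ‖dlist D χ φ * vexp c legs φ‖ ≤ K) :
    ∀ (n : ℕ) (g : LGrp S κ) (rest : Finset κ) (done : Multiset (LGrp S κ)),
      rpot obs M (maxArity legs) g rest done < n → ∀ D : List (S → ℝ),
        gintM A f c legs χ ((g.pend : Multiset (S → ℝ)) + legsOf obs done rest) D
          = ((run A f c legs obs M g rest done).map (oval A f c legs obs χ D)).sum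
  | 0, _, _, _, hn => fun _ => absurd hn (Nat.not_lt_zero _)
  | n + 1, g, rest, done, hn => by
    intro D
    have hn' : rpot obs M (maxArity legs) g rest done ≤ n := Nat.lt_succ_iff.1 hn
    have IH : ∀ g' rest' done', rpot obs M (maxArity legs) g' rest' done' < rpot obs M (maxArity legs) g rest done →
        ∀ D' : List (S → ℝ), gintM A f c legs χ ((g'.pend : Multiset (S → ℝ)) + legsOf obs done' rest') D'
          = ((run A f c legs obs M g' rest' done').map (oval A f c legs obs χ D')).sum :=
      fun g' rest' done' hlt => run_val hA hχ h0 n g' rest' done' (lt_of_lt_of_le hlt hn')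
    by_cases hc : g.complete M = true
    · rw [run_of_complete A f c legs obs M hc]
      simp [oval]
    · obtain ⟨u, L, hp⟩ := List.exists_cons_of_ne_nil (Grp.pend_ne_nil_of_not_complete hc)
      have hnv : g.nv < M := Grp.nv_lt_of_not_complete hc
      -- THE LEFT-HAND SIDE: one integration by parts of the head leg; the pairing sum split by carrier
      have hcons : ((g.pend : Multiset (S → ℝ)) + legsOf obs done rest)
          = u ::ₘ ((L : Multiset (S → ℝ)) + legsOf obs done rest) := by
        rw [hp, ← Multiset.cons_coe, Multiset.cons_add]
      have esplit : (((L : Multiset (S → ℝ)) + legsOf obs done rest).map fun w => ((A⁻¹ *ᵥ u) ⬝ᵥ w) *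
            gintM A f c legs χ (((L : Multiset (S → ℝ)) + legsOf obs done rest).erase w) D).sum
          = (∑ i ∈ range L.length, ((A⁻¹ *ᵥ u) ⬝ᵥ L.getD i 0) *
              gintM A f c legs χ (((L.eraseIdx i : List (S → ℝ)) : Multiset (S → ℝ)) + legsOf obs done rest) D)
            + (done.map fun h => ∑ i ∈ range h.pend.length, ((A⁻¹ *ᵥ u) ⬝ᵥ h.pend.getD i 0) *
              gintM A f c legs χ ((L : Multiset (S → ℝ)) + ((h.pend.eraseIdx i : List (S → ℝ)) : Multiset (S → ℝ))
                + legsOf obs (done.erase h) rest) D).sum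
            + ∑ j ∈ rest, ∑ i ∈ range (obs j).length, ((A⁻¹ *ᵥ u) ⬝ᵥ (obs j).getD i 0) *
              gintM A f c legs χ ((L : Multiset (S → ℝ)) + (((obs j).eraseIdx i : List (S → ℝ)) : Multiset (S → ℝ))
                + legsOf obs done (rest.erase j)) D := by
        unfold legsOf
        rw [Multiset.map_add, Multiset.sum_add, Multiset.map_add, Multiset.sum_add, ← add_assoc]
        refine congrArg₂ (· + ·) (congrArg₂ (· + ·) ?_ ?_) ?_
        · -- legs of the component itself
          rw [sum_range_eraseIdx_eq 0 (fun w Q => ((A⁻¹ *ᵥ u) ⬝ᵥ w) * gintM A f c legs χ (Q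
            + ((done.map fun h => (h.pend : Multiset (S → ℝ))).sum
              + (rest.val.map fun j => (obs j : Multiset (S → ℝ))).sum)) D) L]
          refine congrArg _ (Multiset.map_congr rfl fun w hw => ?_)
          rw [Multiset.erase_add_left_pos _ hw]
        · -- legs of the set-aside components
          have e1 : ∀ w ∈ (done.map fun h => (h.pend : Multiset (S → ℝ))).sum,
              ((L : Multiset (S → ℝ)) + ((done.map fun h => (h.pend : Multiset (S → ℝ))).sum
                + (rest.val.map fun j => (obs j : Multiset (S → ℝ))).sum)).erase w
                = (L : Multiset (S → ℝ)) + ((((done.map fun h => (h.pend : Multiset (S → ℝ))).sum).erase w)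
                  + (rest.val.map fun j => (obs j : Multiset (S → ℝ))).sum) := fun w hw => by
            rw [Multiset.erase_add_right_pos _ (Multiset.mem_add.2 (Or.inl hw)), Multiset.erase_add_left_pos _ hw]
          rw [Multiset.map_congr rfl fun w hw => by rw [e1 w hw],
            sum_map_carriers (fun h : LGrp S κ => (h.pend : Multiset (S → ℝ))) done
              (fun w Q => ((A⁻¹ *ᵥ u) ⬝ᵥ w) * gintM A f c legs χ ((L : Multiset (S → ℝ)) + (Q
                + (rest.val.map fun j => (obs j : Multiset (S → ℝ))).sum)) D)]
          refine congrArg _ (Multiset.map_congr rfl fun h _ => ?_)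
          rw [sum_range_eraseIdx_eq 0 (fun w Q => ((A⁻¹ *ᵥ u) ⬝ᵥ w) *
            gintM A f c legs χ ((L : Multiset (S → ℝ)) + Q
              + (((done.erase h).map fun h => (h.pend : Multiset (S → ℝ))).sum
                + (rest.val.map fun j => (obs j : Multiset (S → ℝ))).sum)) D)]
          refine congrArg _ (Multiset.map_congr rfl fun w _ => ?_)
          simp only [add_assoc]
        · -- legs of the untouched observables
          have e1 : ∀ w ∈ (rest.val.map fun j => (obs j : Multiset (S → ℝ))).sum,
              ((L : Multiset (S → ℝ)) + ((done.map fun h => (h.pend : Multiset (S → ℝ))).sum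
                + (rest.val.map fun j => (obs j : Multiset (S → ℝ))).sum)).erase w
                = (L : Multiset (S → ℝ)) + ((done.map fun h => (h.pend : Multiset (S → ℝ))).sum
                  + (((rest.val.map fun j => (obs j : Multiset (S → ℝ))).sum).erase w)) := fun w hw => by
            rw [Multiset.erase_add_right_pos _ (Multiset.mem_add.2 (Or.inr hw)), Multiset.erase_add_right_pos _ hw]
          rw [Multiset.map_congr rfl fun w hw => by rw [e1 w hw],
            sum_map_carriers (fun j : κ => (obs j : Multiset (S → ℝ))) rest.val
              (fun w Q => ((A⁻¹ *ᵥ u) ⬝ᵥ w) * gintM A f c legs χ ((L : Multiset (S → ℝ))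
                + ((done.map fun h => (h.pend : Multiset (S → ℝ))).sum + Q)) D), Finset.sum_eq_multiset_sum]
          refine congrArg _ (Multiset.map_congr rfl fun j _ => ?_)
          rw [sum_range_eraseIdx_eq 0 (fun w Q => ((A⁻¹ *ᵥ u) ⬝ᵥ w) *
            gintM A f c legs χ ((L : Multiset (S → ℝ)) + Q
              + (((done.map fun h => (h.pend : Multiset (S → ℝ))).sum)
                + ((rest.erase j).val.map fun j => (obs j : Multiset (S → ℝ))).sum)) D)]
          refine congrArg _ (Multiset.map_congr rfl fun w _ => ?_)
          simp only [Finset.erase_val, add_assoc, add_left_comm]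
      rw [hcons, gintM_cons A f c legs χ hA hχ h0, esplit]
      -- THE RIGHT-HAND SIDE: the six groups of outcomes, each by the induction hypothesis
      rw [run_of_not_complete A f c legs obs M hc hp rest done]
      simp only [Multiset.map_add, Multiset.sum_add, sum_map_bind, sum_map_fbind, sum_map_mbind, sum_oval_scale,
        sum_oval_bump, sum_oval_push]
      have r1 : ∀ i ∈ range L.length, ((A⁻¹ *ᵥ u) ⬝ᵥ L.getD i 0) *
            ((run A f c legs obs M ⟨⟨L.eraseIdx i, g.nchi, g.nv⟩, g.lab⟩ rest done).map (oval A f c legs obs χ D)).sum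
          = ((A⁻¹ *ᵥ u) ⬝ᵥ L.getD i 0) *
            gintM A f c legs χ (((L.eraseIdx i : List (S → ℝ)) : Multiset (S → ℝ)) + legsOf obs done rest) D :=
        fun i _ => by rw [← IH _ _ _ (rpot_pair obs M _ rest done hp i) D]
      have r2 : ∀ j ∈ rest.attach, ∑ i ∈ range (obs j).length, ((A⁻¹ *ᵥ u) ⬝ᵥ (obs j).getD i 0) *
            ((run A f c legs obs M ⟨⟨L ++ (obs j).eraseIdx i, g.nchi, g.nv⟩, g.lab ∪ {j.1}⟩ (rest.erase j) done).map
              (oval A f c legs obs χ D)).sum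
          = ∑ i ∈ range (obs j).length, ((A⁻¹ *ᵥ u) ⬝ᵥ (obs j).getD i 0) *
            gintM A f c legs χ ((L : Multiset (S → ℝ)) + (((obs j).eraseIdx i : List (S → ℝ)) : Multiset (S → ℝ))
              + legsOf obs done (rest.erase j)) D :=
        fun j _ => Finset.sum_congr rfl fun i _ => by
          rw [← IH _ _ _ (rpot_pristine obs M _ rest done hp j.2 i (g.lab ∪ {j.1})) D, Multiset.coe_add]
      have r3 : ∀ h ∈ done.attach, ∑ i ∈ range h.1.pend.length, ((A⁻¹ *ᵥ u) ⬝ᵥ h.1.pend.getD i 0) *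
            ((run A f c legs obs M (LGrp.absorb L g h.1 i) rest (done.erase h.1)).map (oval A f c legs obs χ D)).sum
          = ∑ i ∈ range h.1.pend.length, ((A⁻¹ *ᵥ u) ⬝ᵥ h.1.pend.getD i 0) *
            gintM A f c legs χ ((L : Multiset (S → ℝ)) + ((h.1.pend.eraseIdx i : List (S → ℝ)) : Multiset (S → ℝ))
              + legsOf obs (done.erase h.1) rest) D :=
        fun h _ => Finset.sum_congr rfl fun i _ => by
          rw [← IH _ _ _ (rpot_absorb obs M _ rest done hp h.2 i) D, Multiset.coe_add]
          rfl
      have r4 : ((A⁻¹ *ᵥ u) ⬝ᵥ f) *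
            ((run A f c legs obs M ⟨⟨L, g.nchi, g.nv⟩, g.lab⟩ rest done).map (oval A f c legs obs χ D)).sum
          = ((A⁻¹ *ᵥ u) ⬝ᵥ f) * gintM A f c legs χ ((L : Multiset (S → ℝ)) + legsOf obs done rest) D := by
        rw [← IH _ _ _ (rpot_drop obs M _ rest done hp _) D]
      have r5 : ((run A f c legs obs M ⟨⟨L, g.nchi + 1, g.nv⟩, g.lab⟩ rest done).map
            (oval A f c legs obs χ (D ++ [A⁻¹ *ᵥ u]))).sum
          = gintM A f c legs χ ((L : Multiset (S → ℝ)) + legsOf obs done rest) (D ++ [A⁻¹ *ᵥ u]) := by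
        rw [← IH _ _ _ (rpot_drop obs M _ rest done hp _) (D ++ [A⁻¹ *ᵥ u])]
      have r6 : ∀ m ∈ (univ : Finset ι), ∀ j ∈ range (legs m).length, (-(c m * ((A⁻¹ *ᵥ u) ⬝ᵥ (legs m).getD j 0))) *
            ((run A f c legs obs M ⟨⟨L ++ (legs m).eraseIdx j, g.nchi, g.nv + 1⟩, g.lab⟩ rest done).map
              (oval A f c legs obs χ D)).sum
          = (-(c m * ((A⁻¹ *ᵥ u) ⬝ᵥ (legs m).getD j 0))) *
            gintM A f c legs χ ((L : Multiset (S → ℝ)) + legsOf obs done rest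
              + (((legs m).eraseIdx j : List (S → ℝ)) : Multiset (S → ℝ))) D :=
        fun m _ j _ => by
          rw [← IH _ _ _ (rpot_vertex obs M rest done legs hp hnv m j) D]
          congr 2
          change (((L ++ (legs m).eraseIdx j : List (S → ℝ)) : Multiset (S → ℝ))) + _ = _
          rw [← Multiset.coe_add]
          abel
      rw [Finset.sum_congr rfl r1, Finset.sum_congr rfl r2, r4, r5,
        Finset.sum_congr rfl fun m hm => Finset.sum_congr rfl (r6 m hm), Multiset.map_congr rfl r3,
        ← Multiset.attach_map_val' done, ← Finset.sum_attach rest]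
      ring

/-- **The value of a term**: its coefficient times the Gaussian integral of its set-aside components' pending legs
against `(Π_{z ∈ D ++ dirs}∂_z)χ · e^{−V}` (blocks have no legs). [cite: BalabanImbrieJaffe1988, §5.14 p.311–312] -/
def tval (A : Matrix S S ℝ) (f : S → ℝ) (c : ι → ℝ) (legs : ι → List (S → ℝ)) (χ : (S → ℝ) → ℝ)
    (D : List (S → ℝ)) (t : RTerm S κ) : ℝ :=
  t.coef * gintM A f c legs χ ((t.groups.map fun h => (h.pend : Multiset (S → ℝ))).sum) (D ++ t.dirs)

omit [DecidableEq S] [LinearOrder κ] in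
/-- How an outcome acts on values: `tval D (oact o t) = a_o · tval (D ++ D_o) t`, blocks being invisible.
[cite: BalabanImbrieJaffe1988, §5.14 p.311] -/
theorem tval_act (D : List (S → ℝ)) (o : Outcome S κ) (t : RTerm S κ) :
    tval A f c legs χ D (oact o t) = o.a * tval A f c legs χ (D ++ o.D) t := by
  simp only [tval, oact, List.append_assoc, mul_assoc]

omit [DecidableEq S] [LinearOrder κ] in
/-- Blocks are invisible to values. [cite: BalabanImbrieJaffe1988, §5.14 p.311] -/
theorem tval_addConst (D : List (S → ℝ)) (g : LGrp S κ) (t : RTerm S κ) :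
    tval A f c legs χ D (t.addConst g) = tval A f c legs χ D t := rfl

/-- **THE LABELLED COMPONENT EXPANSION LOSES NOTHING**: for complete components `done` set aside, untouched
observables `rest` and `χ′`-directions `D` already present,
`∫ Π_{legsOf done rest}Φ · (Π_D∂)χ · e^{−V} dμ = Σ_{t ∈ expand done rest} tval D t`.
[cite: BalabanImbrieJaffe1988, §5.14 p.311–312] -/
theorem expand_val (hA : A.PosDef) (hχ : ∀ D : List (S → ℝ), ContDiff ℝ 1 (dlist D χ))
    (h0 : ∀ D : List (S → ℝ), ∃ K, ∀ φ, ‖dlist D χ φ * vexp c legs φ‖ ≤ K) :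
    ∀ (n : ℕ) (done : Multiset (LGrp S κ)) (rest : Finset κ), rest.card < n →
      (∀ h ∈ done, h.complete M = true) → ∀ D : List (S → ℝ),
        gintM A f c legs χ (legsOf obs done rest) D = ((expand A f c legs obs M done rest).map (tval A f c legs χ D)).sum
  | 0, _, _, hn => fun _ _ => absurd hn (Nat.not_lt_zero _)
  | n + 1, done, rest, hn => by
    intro hd D
    by_cases h : rest.Nonempty
    · set i := rest.min' h with hi
      rw [expand_of_nonempty A f c legs obs M h, sum_map_mbind, legsOf_erase obs done (rest.min'_mem h)]
      have e0 : (obs (rest.min' h) : Multiset (S → ℝ)) = ((pristine obs (rest.min' h)).pend : Multiset (S → ℝ)) := rfl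
      rw [e0, run_val hA hχ h0 _ _ _ _ (Nat.lt_succ_self _) D]
      rw [← Multiset.attach_map_val' (run A f c legs obs M (pristine obs (rest.min' h)) (rest.erase (rest.min' h)) done)]
      refine congrArg _ (Multiset.map_congr rfl fun o _ => ?_)
      have ho := o.2
      have hcard : o.1.rest.card < n := lt_of_lt_of_le (lt_of_le_of_lt (Finset.card_le_card (run_rest_subset _ _ _ _ ho))
        (Finset.card_erase_lt_of_mem (rest.min'_mem h))) (Nat.lt_succ_iff.1 hn)
      have hdo : ∀ h ∈ o.1.done, h.complete M = true :=
        fun h hh => hd h (Multiset.mem_of_le (run_done_le _ _ _ _ ho) hh)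
      split_ifs with hg
      · -- a constant component: no pending leg; booked as a block
        have hp0 : (o.1.g.pend : Multiset (S → ℝ)) = 0 := by rw [hg.1]; rfl
        rw [oval, hp0, zero_add, expand_val hA hχ h0 n _ _ hcard hdo (D ++ o.1.D), Multiset.map_map,
          ← Multiset.sum_map_mul_left]
        refine congrArg _ (Multiset.map_congr rfl fun t _ => ?_)
        rw [Function.comp_apply, tval_addConst, tval_act]
      · -- a remainder component: set aside
        have hdo' : ∀ h ∈ o.1.g ::ₘ o.1.done, h.complete M = true := fun h hh => by
          rcases Multiset.mem_cons.1 hh with rfl | hh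
          · exact run_complete _ _ _ _ ho
          · exact hdo h hh
        rw [oval, ← legsOf_cons, expand_val hA hχ h0 n _ _ hcard hdo' (D ++ o.1.D), Multiset.map_map,
          ← Multiset.sum_map_mul_left]
        refine congrArg _ (Multiset.map_congr rfl fun t _ => ?_)
        rw [Function.comp_apply, tval_act]
    · rw [expand_of_not_nonempty A f c legs obs M h, Finset.not_nonempty_iff_eq_empty.1 h]
      simp [tval, legsOf]

/-- **THE INTEGRATION BY PARTS OF A PRODUCT OF OBSERVABLES, LABELLED** (p. 311–312): for observables `K` with leg lists
`obs`, in the Gaussian measure `dμ_{C,ℱ}` with weight `χe^{−V}`: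
`∫ Π_{i∈K} Π_{w ∈ obs i}Φ(w) · χe^{−V} dμ = Σ_{t ∈ expand 0 K} coef_t ∫ Π_{legs of t's remainder components}Φ · (Π_{dirs_t}∂)χ · e^{−V} dμ`,
every block of every term a constant component and every set-aside component complete (`expand_sound`).
[cite: BalabanImbrieJaffe1988, §5.14 p.311–312] -/
theorem expand_val_init (hA : A.PosDef) (hχ : ∀ D : List (S → ℝ), ContDiff ℝ 1 (dlist D χ))
    (h0 : ∀ D : List (S → ℝ), ∃ K, ∀ φ, ‖dlist D χ φ * vexp c legs φ‖ ≤ K) (K : Finset κ) :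
    gintM A f c legs χ ((K.val.map fun j => (obs j : Multiset (S → ℝ))).sum) []
      = ((expand A f c legs obs M 0 K).map (tval A f c legs χ [])).sum := by
  have h := expand_val (A := A) (f := f) (c := c) (legs := legs) (χ := χ) (obs := obs) (M := M) hA hχ h0 _ 0 K
    (Nat.lt_succ_self _) (fun h hh => absurd hh (Multiset.notMem_zero _)) []
  simpa [legsOf] using h

end Literature.MathematicalPhysics.QuantumFieldTheory.BalabanImbrieJaffe1984to88.BIJ88LabelledExpansion311

end
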